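import Mathlib
import Summits.Ventures.HodgeRepro2.T5CornerSimple
import Summits.Ventures.HodgeRepro2.T5CornerSmooth
import Summits.Ventures.HodgeRepro2.T5IsotypicProduct
import Summits.Ventures.HodgeRepro2.T5SmoothPassage

/-!
# The corner ring `eRe` as a `k`-algebra, and the corner-level semisimplicity from admissibility

Blind cell `pub-hodge-repro2`, seat p8 (gen 6), Tier-5 kernel support for the N3 record
(MVW chap. 2 III.5, the K-level; CHECK-N3 §7 row N3.10.3).

`T5SmoothPassage` (p393489) passes from the corners `e • V` to the smooth module `V` under the
hypothesis that every corner `e • V` is a semisimple module over the corner ring `eRe`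
(`H(G₁, K) = e_K H e_K`).  In MVW's argument this hypothesis comes from admissibility:
`S[π₁]^K ↪ ∏ π₁^K` with `π₁^K` a FINITE-DIMENSIONAL simple `H(G₁, K)`-module, so that `S[π₁]^K`
is a submodule of a product of copies of a finite-dimensional simple module, hence semisimple
(`T5IsotypicProduct.isSemisimpleModule_of_injective`, p392441).  To apply that file to the corner
ring, `eRe` must be a `k`-algebra and `e • M` a `k`-module compatible with the corner action.
This file supplies exactly that and discharges the hypothesis:

* `cornerAlgebraMap he : k →+* he.Corner`, `c ↦ c • e` (central in `eRe`), and the instance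
  `Algebra k he.Corner` (`RingHom.toAlgebra'`);
* `instModuleCornerModule : Module k (e • M)` (restricting the `k`-action of `M`) and
  `IsScalarTower k he.Corner (e • M)`;
* `cornerEval he : e • V →ₗ[eRe] (Hom_R(V, N) → e • N)`, `x ↦ (f ↦ f x)`, injective when the
  maps `V → N` separate points;
* `isSemisimpleModule_cornerModule` — **the K-level semisimplicity**: `N` simple, `e • N ≠ 0`
  finite-dimensional over `k`, `V` separated ⇒ `e • V` is a semisimple `eRe`-module;
* `isSemisimpleModule_of_isSmoothModule_of_finiteDimensional` and
  `admissibleSmoothPassageEquiv` — the smooth passage with that hypothesis discharged: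
  `V` smooth, `e i • N ≠ 0` finite-dimensional for every `i`, `V` separated, Schur for `N`
  ⇒ `V` semisimple `N`-isotypic and `N ⊗[k] Hom_R(N, V) ≃ₗ[R] V`.

In the record: `R = H(G₁)⁺`, `k = ℂ`, `N = π₁` (irreducible admissible: `e_K • π₁ = π₁^K`
finite-dimensional), `V = S[π₁]`, `e i = e_{K_i}` along small `K_i` with `π₁^{K_i} ≠ 0`.
What stays prose: the dictionary smooth representations ↔ non-degenerate `H(G₁)`-modules and
`e_K • π = π^K`; the printed theorems.  Nothing arithmetic is asserted.

README §8(d): uses an L-value-free non-vanishing device: NO.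
-/

namespace Summit.Ventures.HodgeRepro2.T5CornerAlgebra

open Summit.Ventures.HodgeRepro2.T5CornerSimple
open Summit.Ventures.HodgeRepro2.T5CornerSmooth
open Summit.Ventures.HodgeRepro2.T5IsotypicProduct
open Summit.Ventures.HodgeRepro2.T5SmoothPassage

section Algebra

variable {k R : Type*} [CommSemiring k] [Ring R] [Algebra k R] {e : R} (he : IsIdempotentElem e)

include he in
/-- `c • e` lies in the corner `eRe`. -/
theorem smul_idem_mem_corner (c : k) : c • e ∈ Subsemigroup.corner e := by
  rw [Subsemigroup.mem_corner_iff he]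
  constructor
  · rw [mul_smul_comm, he.eq]
  · rw [smul_mul_assoc, he.eq]

/-- `(1 : eRe) = e`. -/
theorem corner_one_val : (1 : he.Corner).1 = e := rfl

/-- Multiplication in `eRe` is multiplication of the underlying elements. -/
theorem corner_mul_val (a b : he.Corner) : (a * b).1 = a.1 * b.1 := rfl

/-- Addition in `eRe` is addition of the underlying elements. -/
theorem corner_add_val (a b : he.Corner) : (a + b).1 = a.1 + b.1 := rfl

/-- The structure map `k → eRe`, `c ↦ c • e`. -/
def cornerAlgebraMap : k →+* he.Corner where
  toFun c := ⟨c • e, smul_idem_mem_corner he c⟩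
  map_one' := Subtype.ext (by
    show (1 : k) • e = e
    rw [one_smul])
  map_mul' c d := Subtype.ext (by
    show (c * d) • e = (c • e) * (d • e)
    rw [smul_mul_assoc, mul_smul_comm, he.eq, smul_smul])
  map_zero' := Subtype.ext (by
    show (0 : k) • e = 0
    rw [zero_smul])
  map_add' c d := Subtype.ext (by
    show (c + d) • e = c • e + d • e
    rw [add_smul])

/-- `(cornerAlgebraMap he c).1 = c • e`. -/
@[simp] theorem cornerAlgebraMap_val (c : k) : (cornerAlgebraMap he c).1 = c • e := rfl

/-- `c • e` is central in `eRe`. -/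
theorem cornerAlgebraMap_comm (c : k) (x : he.Corner) :
    cornerAlgebraMap he c * x = x * cornerAlgebraMap he c := by
  apply Subtype.ext
  rw [corner_mul_val, corner_mul_val, cornerAlgebraMap_val, smul_mul_assoc, mul_smul_comm,
    corner_mul_left he x, corner_mul_right he x]

/-- The corner ring `eRe` is a `k`-algebra with structure map `c ↦ c • e`. -/
instance instAlgebraCorner : Algebra k he.Corner :=
  (cornerAlgebraMap he).toAlgebra' (cornerAlgebraMap_comm he)

/-- `algebraMap k eRe = cornerAlgebraMap`. -/
theorem algebraMap_corner_eq : (algebraMap k he.Corner) = cornerAlgebraMap he := rfl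

/-- The `k`-action on `eRe`: `c • x = (c • e) * x`, i.e. `(c • x).1 = c • x.1`. -/
theorem corner_smul_val (c : k) (x : he.Corner) : (c • x).1 = c • x.1 := by
  change (cornerAlgebraMap he c * x).1 = c • x.1
  rw [corner_mul_val, cornerAlgebraMap_val, smul_mul_assoc, corner_mul_left he x]

end Algebra

section Module

variable {k R : Type*} [CommSemiring k] [Ring R] [Algebra k R] {e : R}
  {M : Type*} [AddCommGroup M] [Module R M] [Module k M] [IsScalarTower k R M]

/-- `e • M` is stable under the `k`-action of `M` (`e • (c • m) = c • (e • m)`). -/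
theorem smul_mem_cornerModule (c : k) {x : M} (hx : x ∈ cornerModule e M) :
    c • x ∈ cornerModule e M := by
  rw [mem_cornerModule_iff'] at hx ⊢
  obtain ⟨m, rfl⟩ := hx
  exact ⟨c • m, by rw [smul_comm]⟩

/-- The `k`-module structure of `e • M` restricted from `M`. -/
instance instModuleCornerModule : Module k ↥(cornerModule e M) where
  smul c x := ⟨c • (x : M), smul_mem_cornerModule c x.2⟩
  one_smul x := Subtype.ext (one_smul k (x : M))
  mul_smul c d x := Subtype.ext (mul_smul c d (x : M))
  smul_zero c := Subtype.ext (smul_zero c)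
  smul_add c x y := Subtype.ext (smul_add c (x : M) (y : M))
  add_smul c d x := Subtype.ext (add_smul c d (x : M))
  zero_smul x := Subtype.ext (zero_smul k (x : M))

/-- `((c • x : e • M) : M) = c • (x : M)`. -/
@[simp] theorem cornerModule_smul_val (c : k) (x : ↥(cornerModule e M)) :
    ((c • x : ↥(cornerModule e M)) : M) = c • (x : M) := rfl

/-- The corner action and the `k`-action on `e • M` form a scalar tower:
`(c • r) • x = c • (r • x)`. -/
instance instIsScalarTowerCorner (he : IsIdempotentElem e) :
    IsScalarTower k he.Corner ↥(cornerModule e M) where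
  smul_assoc c r x := by
    apply Subtype.ext
    change (c • r : he.Corner).1 • (x : M) = c • (r.1 • (x : M))
    rw [corner_smul_val he, smul_assoc]

/-- The `k`-subspace `cornerSubmodule e M` of `T5CornerSmooth` and the `k`-module `e • M` of this
file are the same object: finite-dimensionality transfers. -/
theorem finiteDimensional_cornerModule_iff {k : Type*} [Field k] [Algebra k R] [Module k M]
    [IsScalarTower k R M] :
    FiniteDimensional k ↥(cornerModule e M) ↔
      FiniteDimensional k ↥(cornerSubmodule (k := k) e M) :=
  Iff.rfl

end Module

section Eval

variable {k R : Type*} [Field k] [Ring R] [Algebra k R] {e : R} (he : IsIdempotentElem e)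
  {N : Type*} [AddCommGroup N] [Module R N] [Module k N] [IsScalarTower k R N]
  {V : Type*} [AddCommGroup V] [Module R V]

include he in
/-- `f : V → N` maps `e • V` into `e • N`. -/
theorem map_mem_cornerModule (f : V →ₗ[R] N) {x : V} (hx : x ∈ cornerModule e V) :
    f x ∈ cornerModule e N := by
  rw [mem_cornerModule_iff he] at hx ⊢
  rw [← map_smul, hx]

/-- **Evaluation at all maps `V → N`, corner level**: `e • V →ₗ[eRe] (Hom_R(V, N) → e • N)`,
`x ↦ (f ↦ f x)`. -/
def cornerEval : ↥(cornerModule e V) →ₗ[he.Corner] ((V →ₗ[R] N) → ↥(cornerModule e N)) where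
  toFun x f := ⟨f (x : V), map_mem_cornerModule he f x.2⟩
  map_add' x y := by
    funext f
    apply Subtype.ext
    change f ((x : V) + (y : V)) = f (x : V) + f (y : V)
    rw [map_add]
  map_smul' c x := by
    funext f
    apply Subtype.ext
    change f (c.1 • (x : V)) = c.1 • f (x : V)
    rw [map_smul]

/-- `(cornerEval he x f : N) = f x`. -/
@[simp] theorem cornerEval_apply_val (x : ↥(cornerModule e V)) (f : V →ₗ[R] N) :
    ((cornerEval he x f : ↥(cornerModule e N)) : N) = f (x : V) := rfl

/-- `cornerEval` is injective when the maps `V → N` separate the points of `V`. -/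
theorem cornerEval_injective (hV : Separated R N V) :
    Function.Injective (cornerEval he (N := N) (V := V)) := by
  intro x y hxy
  apply Subtype.ext
  by_contra hne
  have hne' : (x : V) - (y : V) ≠ 0 := sub_ne_zero.mpr hne
  obtain ⟨f, hf⟩ := hV _ hne'
  apply hf
  have := congrArg (fun φ => ((φ f : ↥(cornerModule e N)) : N)) hxy
  simp only [cornerEval_apply_val] at this
  rw [map_sub, this, sub_self]

/-- **The K-level semisimplicity (MVW III.5, the corner step).** For `N` simple with `e • N ≠ 0`
finite-dimensional over `k`, and `V` separated by its maps to `N`, the corner `e • V` is a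
semisimple module over the corner ring `eRe` (it embeds into a product of copies of the
finite-dimensional simple `eRe`-module `e • N`; `T5IsotypicProduct.isSemisimpleModule_of_injective`). -/
theorem isSemisimpleModule_cornerModule [IsSimpleModule R N] (hV : Separated R N V)
    (hN : ∃ n : N, e • n ≠ 0) [FiniteDimensional k ↥(cornerModule e N)] :
    IsSemisimpleModule he.Corner ↥(cornerModule e V) :=
  haveI : IsSimpleModule he.Corner ↥(cornerModule e N) := isSimpleModule_cornerModule he hN
  isSemisimpleModule_of_injective k (cornerEval he) (cornerEval_injective he hV)

end Eval

section Passage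

variable {k R : Type*} [Field k] [Ring R] [Algebra k R] {ι : Type*} (e : ι → R)
  (he : ∀ i, IsIdempotentElem (e i))
  {N : Type*} [AddCommGroup N] [Module R N] [Module k N] [IsScalarTower k R N]
  {V : Type*} [AddCommGroup V] [Module R V] [Module k V] [IsScalarTower k R V]

omit [Module k V] [IsScalarTower k R V] in
include he in
/-- **The smooth passage from admissibility.** `V` smooth for the idempotents `e i`, separated by
its maps to the simple module `N`, with `e i • N ≠ 0` finite-dimensional for every `i` ⇒ `V` is a
semisimple `R`-module. -/
theorem isSemisimpleModule_of_isSmoothModule_of_finiteDimensional [IsSimpleModule R N]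
    (hV : Separated R N V) (hs : IsSmoothModule e (M := V)) (hN : ∀ i, ∃ n : N, e i • n ≠ 0)
    [∀ i, FiniteDimensional k ↥(cornerModule (e i) N)] :
    IsSemisimpleModule R V :=
  isSemisimpleModule_of_isSmoothModule e he hV hs hN
    (fun i => isSemisimpleModule_cornerModule (k := k) (he i) hV (hN i))

include he in
/-- **MVW III.3 + III.5 from admissibility**: under the hypotheses above and Schur for `N`,
`N ⊗[k] Hom_R(N, V) ≃ₗ[R] V`, `n ⊗ f ↦ f n`. -/
noncomputable def admissibleSmoothPassageEquiv [IsSimpleModule R N]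
    (hSchur : ∀ φ : N →ₗ[R] N, ∃ c : k, ∀ x, φ x = c • x)
    (hV : Separated R N V) (hs : IsSmoothModule e (M := V)) (hN : ∀ i, ∃ n : N, e i • n ≠ 0)
    [∀ i, FiniteDimensional k ↥(cornerModule (e i) N)] :
    TensorProduct k N (N →ₗ[R] V) ≃ₗ[R] V :=
  smoothPassageEquiv e he hSchur hV hs hN
    (fun i => isSemisimpleModule_cornerModule (k := k) (he i) hV (hN i))

/-- `admissibleSmoothPassageEquiv (n ⊗ f) = f n`. -/
theorem admissibleSmoothPassageEquiv_tmul [IsSimpleModule R N]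
    (hSchur : ∀ φ : N →ₗ[R] N, ∃ c : k, ∀ x, φ x = c • x)
    (hV : Separated R N V) (hs : IsSmoothModule e (M := V)) (hN : ∀ i, ∃ n : N, e i • n ≠ 0)
    [∀ i, FiniteDimensional k ↥(cornerModule (e i) N)] (n : N) (f : N →ₗ[R] V) :
    admissibleSmoothPassageEquiv e he hSchur hV hs hN (n ⊗ₜ[k] f) = f n :=
  smoothPassageEquiv_tmul e he hSchur hV hs hN _ n f

/-- The equivalence intertwines a family of operators `ρ g` on `V` (the `G₂`-action of MVW III.3)
with `1 ⊗ (ρ g)_*` on `N ⊗ Hom_R(N, V)` (`T5IsotypicHom.evEquiv_postcomp`). -/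
theorem admissibleSmoothPassageEquiv_postcomp [IsSimpleModule R N]
    (hSchur : ∀ φ : N →ₗ[R] N, ∃ c : k, ∀ x, φ x = c • x)
    (hV : Separated R N V) (hs : IsSmoothModule e (M := V)) (hN : ∀ i, ∃ n : N, e i • n ≠ 0)
    [∀ i, FiniteDimensional k ↥(cornerModule (e i) N)] {G₂ : Type*} (ρ : G₂ → V →ₗ[R] V) (g : G₂)
    (x : TensorProduct k N (N →ₗ[R] V)) :
    admissibleSmoothPassageEquiv e he hSchur hV hs hN
        (TensorProduct.map LinearMap.id (T5IsotypicHom.postcomp k R N V (ρ g)) x) =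
      ρ g (admissibleSmoothPassageEquiv e he hSchur hV hs hN x) := by
  haveI : Nontrivial N := IsSimpleModule.nontrivial R N
  haveI : IsSemisimpleModule R V := isSemisimpleModule_of_isSmoothModule e he hV hs hN
    (fun i => isSemisimpleModule_cornerModule (k := k) (he i) hV (hN i))
  exact T5IsotypicHom.evEquiv_postcomp hSchur (isIsotypicOfType_of_separated hV) ρ g x

include he in
/-- **`S[N] ≅ N ⊗ Hom(N, S[N])` from admissibility**: for `V = S[N] = S ⧸ S(N)` the separation
hypothesis is automatic. -/
noncomputable def admissibleIsotypicQuotEquiv [IsSimpleModule R N]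
    (hSchur : ∀ φ : N →ₗ[R] N, ∃ c : k, ∀ x, φ x = c • x)
    (S : Type*) [AddCommGroup S] [Module R S] [Module k S] [IsScalarTower k R S]
    (hs : IsSmoothModule e (M := S ⧸ isotypicKer R N S)) (hN : ∀ i, ∃ n : N, e i • n ≠ 0)
    [∀ i, FiniteDimensional k ↥(cornerModule (e i) N)] :
    TensorProduct k N (N →ₗ[R] S ⧸ isotypicKer R N S) ≃ₗ[R] S ⧸ isotypicKer R N S :=
  admissibleSmoothPassageEquiv e he hSchur (separated_isotypicQuot S) hs hN

end Passage

end Summit.Ventures.HodgeRepro2.T5CornerAlgebra
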